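import Summits.AnomalousDissipation.AnomalousDissipation.Theorems.SolenoidalFractalHomogenisationRealisedQuasiStaticCellLawSlavedLadderSlow
import HarnessLib

/-!
# K2R `RealisedQuasiStaticCellLaw`, line `floquet-bloch`, stub `stub_lowSectorDecay` (S1D): the slaved-ladder Lyapunov
# functional, II — the fast remainder (defect forcing of the slaved ladder)

Summits-side helper (everything proved; no definitions, no named facts; `--supports stmt-AnomalousDissipation-20446`).
Second of three files. With `r_J = v_J − h_J v₀` (`J ≠ 0`; `h_{±1}` the first-order slaving profile, `h_J = 0` else)
the fast remainders solve the SAME ladder restricted to `W ∖ 0` (exchange invisible in the energy,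
`re_sum_conj_mul_link_eq_zero`) plus a defect forcing `Q_J` supported on `J = ±1, ±2`:
`Q_{±1} = v₀(Λg²σ h_{±1} − h_{±1}') + h_{±1} gΛ X₁`, `Q_{±2} = ∓gΛ s h_{±1} v₀`, whose size is
`O(γ(Λg_T³σ + g_D + Λg_T²)/Δ)·‖v₀‖ + O(Λg_T²γ²/Δ)·√F` — the cancellation `−Λ(d₁−d₀)h₁ − gΛs₀ = 0` is the point.
Result (`slavedLadder_fast_le`): the time derivative of `F = Σ_{J≠0}‖r_J‖²` along the ladder is at most
`−2Λ(d₀+Δ)F + 4‖v₀‖√F·γ(Λg_T³σ + g_D + Λg_T²)/Δ + 4Λg_T²γ²F/Δ`, uniformly in the window `W`.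
-/

set_option linter.dupNamespace false -- layout D-0017: `AnomalousDissipation.AnomalousDissipation` repeats by design

namespace Summit.AnomalousDissipation.AnomalousDissipation.Theorems.SolenoidalFractalHomogenisation.RealisedQuasiStaticCellLaw

noncomputable section

open Set Finset Complex
open scoped BigOperators ComplexConjugate

/-- **Fast-remainder bound of the slaved ladder.** At one instant: state `x` vanishing off `W ∋ ±1`, ladder field `Fv`
with coupling value `gt` (`|gt| ≤ g_T`) and its time derivative `gdt` (`|gdt| ≤ g_D`) entering the profile derivative
`hd'`; links `|s_J| ≤ 1` on `W`, gap `d_J ≥ d₀ + Δ` off `0`. Then the derivative of `F = Σ_{J∈W∖0} ‖x_J − hf_J x₀‖²`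
along the ladder, `Σ_{J∈W∖0} 2 Re((Fv_J − (hd'_J x₀ + hf_J Fv₀)) conj(x_J − hf_J x₀))`, is at most
`−2Λ(d₀+Δ)F + 4‖x₀‖√F·γ(Λg_T³σ + g_D + Λg_T²)/Δ + 4(Λ g_T² γ² F/Δ)`. -/
theorem slavedLadder_fast_le (W : Finset ℤ) (h1 : (1 : ℤ) ∈ W) (hm1 : (-1 : ℤ) ∈ W)
    (d s : ℤ → ℝ) (Λ gT gD Δ γ σ gt gdt : ℝ) (x Fv : ℤ → ℂ) (hf hd' : ℤ → ℝ)
    (hs : ∀ J ∈ W, |s J| ≤ 1) (hγ : γ ^ 2 = s 0 ^ 2 + s (-1) ^ 2) (hγ0 : 0 ≤ γ)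
    (hσ : σ = s (-1) ^ 2 / (d (-1) - d 0) + s 0 ^ 2 / (d 1 - d 0))
    (hΔ0 : 0 < Δ) (hΔ : ∀ J ∈ W, J ≠ 0 → d 0 + Δ ≤ d J) (hΛ : 0 < Λ)
    (hgt : |gt| ≤ gT) (hgdt : |gdt| ≤ gD)
    (hx : ∀ K, K ∉ W → x K = 0)
    (hFv : ∀ J, Fv J = -(Λ : ℂ) * ((d J : ℂ) * x J) -
      (gt : ℂ) * (Λ : ℂ) * ((s (J - 1) : ℂ) * x (J - 1) - (s J : ℂ) * x (J + 1)))
    (hhf : ∀ J, hf J = if J = 1 then -(gt * s 0 / (d 1 - d 0))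
      else if J = -1 then gt * s (-1) / (d (-1) - d 0) else 0)
    (hhd : ∀ J, hd' J = if J = 1 then -(gdt * s 0 / (d 1 - d 0))
      else if J = -1 then gdt * s (-1) / (d (-1) - d 0) else 0) :
    ∑ J ∈ W.erase 0,
        2 * ((Fv J - ((hd' J : ℂ) * x 0 + (hf J : ℂ) * Fv 0)) * conj (x J - (hf J : ℂ) * x 0)).re ≤
      -2 * Λ * (d 0 + Δ) * (∑ J ∈ W.erase 0, ‖x J - (hf J : ℂ) * x 0‖ ^ 2) +
        4 * (‖x 0‖ * Real.sqrt (∑ J ∈ W.erase 0, ‖x J - (hf J : ℂ) * x 0‖ ^ 2) *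
          (γ * (Λ * gT ^ 3 * σ + gD + Λ * gT ^ 2) / Δ)) +
        4 * (Λ * gT ^ 2 * γ ^ 2 * (∑ J ∈ W.erase 0, ‖x J - (hf J : ℂ) * x 0‖ ^ 2) / Δ) := by
  classical
  set W' := W.erase 0 with hW'
  have h1W' : (1 : ℤ) ∈ W' := Finset.mem_erase.2 ⟨by norm_num, h1⟩
  have hm1W' : (-1 : ℤ) ∈ W' := Finset.mem_erase.2 ⟨by norm_num, hm1⟩
  -- gaps and signs
  have hδp : Δ ≤ d 1 - d 0 := by linarith [hΔ 1 h1 (by norm_num)]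
  have hδm : Δ ≤ d (-1) - d 0 := by linarith [hΔ (-1) hm1 (by norm_num)]
  have hδp0 : 0 < d 1 - d 0 := lt_of_lt_of_le hΔ0 hδp
  have hδm0 : 0 < d (-1) - d 0 := lt_of_lt_of_le hΔ0 hδm
  have hσ0 : 0 ≤ σ := by rw [hσ]; positivity
  have hgT0 : 0 ≤ gT := (abs_nonneg _).trans hgt
  have hgD0 : 0 ≤ gD := (abs_nonneg _).trans hgdt
  have hs0γ : |s 0| ≤ γ := by
    rw [← Real.sqrt_sq hγ0]
    exact Real.abs_le_sqrt (by rw [hγ]; linarith only [sq_nonneg (s (-1))])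
  have hsm1γ : |s (-1)| ≤ γ := by
    rw [← Real.sqrt_sq hγ0]
    exact Real.abs_le_sqrt (by rw [hγ]; linarith only [sq_nonneg (s 0)])
  have hs1 : |s 1| ≤ 1 := hs 1 h1
  -- the slaving profile
  have hf1 : hf 1 = -(gt * s 0 / (d 1 - d 0)) := by rw [hhf]; simp
  have hfm1 : hf (-1) = gt * s (-1) / (d (-1) - d 0) := by rw [hhf]; norm_num
  have hf_else : ∀ J, J ≠ 1 → J ≠ -1 → hf J = 0 := fun J hJ hJ' => by rw [hhf, if_neg hJ, if_neg hJ']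
  have hd1 : hd' 1 = -(gdt * s 0 / (d 1 - d 0)) := by rw [hhd]; simp
  have hdm1 : hd' (-1) = gdt * s (-1) / (d (-1) - d 0) := by rw [hhd]; norm_num
  have hd_else : ∀ J, J ≠ 1 → J ≠ -1 → hd' J = 0 := fun J hJ hJ' => by rw [hhd, if_neg hJ, if_neg hJ']
  -- bounds on the profile: `|hf(±1)| ≤ gT γ/Δ`, `|hd'(±1)| ≤ gD γ/Δ`
  have hquot : ∀ {a b c δ : ℝ}, |a| ≤ c → 0 ≤ c → |b| ≤ γ → Δ ≤ δ → 0 < δ → |a * b / δ| ≤ c * γ / Δ := by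
    intro a b c δ ha hc hb hδ hδ0
    rw [abs_div, abs_mul, abs_of_pos hδ0]
    exact div_le_div₀ (by positivity) (mul_le_mul ha hb (abs_nonneg _) hc) hΔ0 hδ
  have hbf1 : |hf 1| ≤ gT * γ / Δ := by rw [hf1, abs_neg]; exact hquot hgt hgT0 hs0γ hδp hδp0
  have hbfm1 : |hf (-1)| ≤ gT * γ / Δ := by rw [hfm1]; exact hquot hgt hgT0 hsm1γ hδm hδm0
  have hbd1 : |hd' 1| ≤ gD * γ / Δ := by rw [hd1, abs_neg]; exact hquot hgdt hgD0 hs0γ hδp hδp0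
  have hbdm1 : |hd' (-1)| ≤ gD * γ / Δ := by rw [hdm1]; exact hquot hgdt hgD0 hsm1γ hδm hδm0
  -- the fast remainder `R` (zero at the slow index and off the window)
  obtain ⟨R, hRdef⟩ : ∃ R : ℤ → ℂ, R = fun K => if K = 0 then 0 else x K - (hf K : ℂ) * x 0 := ⟨_, rfl⟩
  have hR0 : R 0 = 0 := by rw [hRdef]; simp
  have hRne : ∀ K, K ≠ 0 → R K = x K - (hf K : ℂ) * x 0 := fun K hK => by rw [hRdef]; simp [hK]
  have hRout : ∀ K, K ∉ W' → R K = 0 := by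
    intro K hK
    by_cases hK0 : K = 0
    · rw [hK0, hR0]
    · have hKW : K ∉ W := fun h => hK (Finset.mem_erase.2 ⟨hK0, h⟩)
      have hK1 : K ≠ 1 := fun h => hKW (h ▸ h1)
      have hKm1 : K ≠ -1 := fun h => hKW (h ▸ hm1)
      rw [hRne K hK0, hx K hKW, hf_else K hK1 hKm1]
      simp
  have hxR : ∀ K, K ≠ 0 → x K = R K + (hf K : ℂ) * x 0 := fun K hK => by rw [hRne K hK]; ring
  -- energies
  obtain ⟨F, hFdef⟩ : ∃ F : ℝ, F = ∑ J ∈ W', ‖R J‖ ^ 2 := ⟨_, rfl⟩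
  have hFeq : ∑ J ∈ W', ‖x J - (hf J : ℂ) * x 0‖ ^ 2 = F := by
    rw [hFdef]; exact Finset.sum_congr rfl fun J hJ => by rw [hRne J (Finset.ne_of_mem_erase hJ)]
  have hF0 : 0 ≤ F := by rw [hFdef]; exact Finset.sum_nonneg fun J _ => by positivity
  obtain ⟨V, hVdef⟩ : ∃ V : ℝ, V = ‖x 0‖ := ⟨_, rfl⟩
  have hV0 : 0 ≤ V := by rw [hVdef]; exact norm_nonneg _
  obtain ⟨Y, hYdef⟩ : ∃ Y : ℝ, Y = Real.sqrt F := ⟨_, rfl⟩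
  have hY0 : 0 ≤ Y := by rw [hYdef]; exact Real.sqrt_nonneg _
  have hYsq : Y ^ 2 = F := by rw [hYdef]; exact Real.sq_sqrt hF0
  obtain ⟨Y₁, hY₁def⟩ : ∃ Y₁ : ℝ, Y₁ = Real.sqrt (‖R (-1)‖ ^ 2 + ‖R 1‖ ^ 2) := ⟨_, rfl⟩
  have hY₁0 : 0 ≤ Y₁ := by rw [hY₁def]; exact Real.sqrt_nonneg _
  have hpairF : ‖R (-1)‖ ^ 2 + ‖R 1‖ ^ 2 ≤ F := by
    rw [hFdef]
    have hsub : ({-1, 1} : Finset ℤ) ⊆ W' := by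
      intro J hJ
      simp only [Finset.mem_insert, Finset.mem_singleton] at hJ
      rcases hJ with rfl | rfl
      · exact hm1W'
      · exact h1W'
    have := Finset.sum_le_sum_of_subset_of_nonneg hsub (fun J _ _ => sq_nonneg ‖R J‖)
    rw [Finset.sum_pair (by norm_num)] at this
    exact this
  have hY₁Y : Y₁ ≤ Y := by rw [hY₁def, hYdef]; exact Real.sqrt_le_sqrt hpairF
  have hRle : ∀ J ∈ W', ‖R J‖ ≤ Y := fun J hJ => by
    rw [← Real.sqrt_sq (norm_nonneg (R J)), hYdef, hFdef]
    exact Real.sqrt_le_sqrt (Finset.single_le_sum (fun K _ => sq_nonneg ‖R K‖) hJ)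
  -- the slow feed `X₁ = s₋₁ R₋₁ − s₀ R₁`
  obtain ⟨X₁, hX₁def⟩ : ∃ X₁ : ℂ, X₁ = (s (-1) : ℂ) * R (-1) - (s 0 : ℂ) * R 1 := ⟨_, rfl⟩
  have hX₁ : ‖X₁‖ ≤ γ * Y₁ := by
    have h := norm_sub_two_le_sqrt (s (-1)) (s 0) (R (-1)) (R 1)
    have e : Real.sqrt (s (-1) ^ 2 + s 0 ^ 2) = γ := by
      rw [← Real.sqrt_sq hγ0, hγ, add_comm]
    rw [e, ← hY₁def, ← hX₁def] at h
    exact h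
  have hX₁Y : ‖X₁‖ ≤ γ * Y := hX₁.trans (mul_le_mul_of_nonneg_left hY₁Y hγ0)
  -- KEY IDENTITY (second-order slaving): `s₋₁ x₋₁ − s₀ x₁ = X₁ + gt σ x₀`
  have hslow_id : (s (-1) : ℂ) * x (-1) - (s 0 : ℂ) * x 1 = X₁ + ((gt * σ : ℝ) : ℂ) * x 0 := by
    rw [hxR (-1) (by norm_num), hxR 1 (by norm_num), hf1, hfm1, hX₁def, hσ]
    push_cast
    ring
  ------------------------------------------------------------------
  -- (B) the fast terms: decomposition `rJ' = ladder(R)_J + Q_J`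
  ------------------------------------------------------------------
  obtain ⟨Q, hQdef⟩ : ∃ Q : ℤ → ℂ, Q = fun J => (Fv J - ((hd' J : ℂ) * x 0 + (hf J : ℂ) * Fv 0)) -
    (-(Λ : ℂ) * ((d J : ℂ) * R J) - (gt : ℂ) * (Λ : ℂ) * ((s (J - 1) : ℂ) * R (J - 1) - (s J : ℂ) * R (J + 1))) :=
    ⟨_, rfl⟩
  -- the closed forms of `Q` at `J = ±1, ±2` and `Q = 0` elsewhere
  obtain ⟨cB, hcBdef⟩ : ∃ cB : ℝ, cB = γ * (Λ * gT ^ 3 * σ + gD + Λ * gT ^ 2) / Δ := ⟨_, rfl⟩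
  have hcB0 : 0 ≤ cB := by rw [hcBdef]; positivity
  obtain ⟨qa, hqa⟩ : ∃ qa : ℝ, qa = V * (γ * (Λ * gT ^ 3 * σ + gD) / Δ) + Λ * gT ^ 2 * γ ^ 2 * Y₁ / Δ := ⟨_, rfl⟩
  obtain ⟨qb, hqb⟩ : ∃ qb : ℝ, qb = Λ * gT ^ 2 * γ * V / Δ := ⟨_, rfl⟩
  have hqa0 : 0 ≤ qa := by rw [hqa]; positivity
  have hqb0 : 0 ≤ qb := by rw [hqb]; positivity
  -- generic coefficient bound: `|gt|^k ≤ gT^k`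
  have hgt2 : gt ^ 2 ≤ gT ^ 2 := by rw [← sq_abs]; exact pow_le_pow_left₀ (abs_nonneg _) hgt 2
  have hgt3 : |gt| ^ 3 ≤ gT ^ 3 := pow_le_pow_left₀ (abs_nonneg _) hgt 3
  have hQ1 : ‖Q 1‖ ≤ qa := by
    have e : Q 1 = x 0 * (((gdt * s 0 / (d 1 - d 0) - gt ^ 3 * Λ * σ * (s 0 / (d 1 - d 0)) : ℝ) : ℂ)) -
        (((gt ^ 2 * Λ * (s 0 / (d 1 - d 0)) : ℝ) : ℂ)) * X₁ := by
      have hx1 := hxR 1 (by norm_num)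
      have hx2 : x 2 = R 2 := by
        rw [hRne 2 (by norm_num), hf_else 2 (by norm_num) (by norm_num)]; simp
      have hne : ((d 1 : ℂ) - (d 0 : ℂ)) ≠ 0 := by
        rw [← Complex.ofReal_sub]; exact Complex.ofReal_ne_zero.2 hδp0.ne'
      have hinv : ((d 1 : ℂ) - (d 0 : ℂ)) * ((d 1 : ℂ) - (d 0 : ℂ))⁻¹ = 1 := mul_inv_cancel₀ hne
      simp only [hQdef, hFv, hd1, hf1]
      norm_num
      rw [hR0, hslow_id, hx2, hx1, hf1]
      push_cast
      linear_combination ((Λ : ℂ) * (gt : ℂ) * (s 0 : ℂ) * x 0) * hinv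
    rw [e]
    refine (norm_sub_le _ _).trans ?_
    rw [norm_mul, norm_mul, Complex.norm_real, Complex.norm_real, Real.norm_eq_abs, Real.norm_eq_abs, ← hVdef]
    have hc1 : |gdt * s 0 / (d 1 - d 0) - gt ^ 3 * Λ * σ * (s 0 / (d 1 - d 0))| ≤
        γ * (Λ * gT ^ 3 * σ + gD) / Δ := by
      refine (abs_sub _ _).trans ?_
      have ha : |gdt * s 0 / (d 1 - d 0)| ≤ gD * γ / Δ := hquot hgdt hgD0 hs0γ hδp hδp0
      have hb : |gt ^ 3 * Λ * σ * (s 0 / (d 1 - d 0))| ≤ gT ^ 3 * Λ * σ * (γ / Δ) := by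
        rw [abs_mul, abs_mul, abs_mul, abs_div, abs_of_pos hΛ, abs_of_nonneg hσ0, abs_of_pos hδp0, abs_pow]
        refine mul_le_mul (mul_le_mul_of_nonneg_right (mul_le_mul_of_nonneg_right hgt3 hΛ.le) hσ0)
          (div_le_div₀ hγ0 hs0γ hΔ0 hδp) (by positivity) (by positivity)
      have : gD * γ / Δ + gT ^ 3 * Λ * σ * (γ / Δ) = γ * (Λ * gT ^ 3 * σ + gD) / Δ := by ring
      linarith only [ha, hb, this]
    have hc2 : |gt ^ 2 * Λ * (s 0 / (d 1 - d 0))| ≤ gT ^ 2 * Λ * (γ / Δ) := by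
      rw [abs_mul, abs_mul, abs_div, abs_of_pos hΛ, abs_of_pos hδp0, abs_pow, sq_abs]
      exact mul_le_mul (mul_le_mul_of_nonneg_right hgt2 hΛ.le) (div_le_div₀ hγ0 hs0γ hΔ0 hδp)
        (by positivity) (by positivity)
    have t1 : V * |gdt * s 0 / (d 1 - d 0) - gt ^ 3 * Λ * σ * (s 0 / (d 1 - d 0))| ≤
        V * (γ * (Λ * gT ^ 3 * σ + gD) / Δ) := mul_le_mul_of_nonneg_left hc1 hV0
    have t2 : |gt ^ 2 * Λ * (s 0 / (d 1 - d 0))| * ‖X₁‖ ≤ gT ^ 2 * Λ * (γ / Δ) * (γ * Y₁) :=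
      mul_le_mul hc2 hX₁ (norm_nonneg _) (by positivity)
    have : gT ^ 2 * Λ * (γ / Δ) * (γ * Y₁) = Λ * gT ^ 2 * γ ^ 2 * Y₁ / Δ := by ring
    rw [hqa]; linarith only [t1, t2, this]
  have hQm1 : ‖Q (-1)‖ ≤ qa := by
    have e : Q (-1) = x 0 * (((-(gdt * s (-1) / (d (-1) - d 0)) + gt ^ 3 * Λ * σ * (s (-1) / (d (-1) - d 0)) : ℝ) : ℂ)) +
        (((gt ^ 2 * Λ * (s (-1) / (d (-1) - d 0)) : ℝ) : ℂ)) * X₁ := by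
      have hxm1 := hxR (-1) (by norm_num)
      have hxm2 : x (-2) = R (-2) := by
        rw [hRne (-2) (by norm_num), hf_else (-2) (by norm_num) (by norm_num)]; simp
      have hne : ((d (-1) : ℂ) - (d 0 : ℂ)) ≠ 0 := by
        rw [← Complex.ofReal_sub]; exact Complex.ofReal_ne_zero.2 hδm0.ne'
      have hinv : ((d (-1) : ℂ) - (d 0 : ℂ)) * ((d (-1) : ℂ) - (d 0 : ℂ))⁻¹ = 1 := mul_inv_cancel₀ hne
      simp only [hQdef, hFv, hdm1, hfm1]
      norm_num
      rw [hR0, hslow_id, hxm2, hxm1, hfm1]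
      push_cast
      linear_combination (-((Λ : ℂ) * (gt : ℂ) * (s (-1) : ℂ) * x 0)) * hinv
    rw [e]
    refine (norm_add_le _ _).trans ?_
    rw [norm_mul, norm_mul, Complex.norm_real, Complex.norm_real, Real.norm_eq_abs, Real.norm_eq_abs, ← hVdef]
    have hc1 : |-(gdt * s (-1) / (d (-1) - d 0)) + gt ^ 3 * Λ * σ * (s (-1) / (d (-1) - d 0))| ≤
        γ * (Λ * gT ^ 3 * σ + gD) / Δ := by
      refine (abs_add_le _ _).trans ?_
      have ha : |-(gdt * s (-1) / (d (-1) - d 0))| ≤ gD * γ / Δ := by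
        rw [abs_neg]; exact hquot hgdt hgD0 hsm1γ hδm hδm0
      have hb : |gt ^ 3 * Λ * σ * (s (-1) / (d (-1) - d 0))| ≤ gT ^ 3 * Λ * σ * (γ / Δ) := by
        rw [abs_mul, abs_mul, abs_mul, abs_div, abs_of_pos hΛ, abs_of_nonneg hσ0, abs_of_pos hδm0, abs_pow]
        refine mul_le_mul (mul_le_mul_of_nonneg_right (mul_le_mul_of_nonneg_right hgt3 hΛ.le) hσ0)
          (div_le_div₀ hγ0 hsm1γ hΔ0 hδm) (by positivity) (by positivity)
      have : gD * γ / Δ + gT ^ 3 * Λ * σ * (γ / Δ) = γ * (Λ * gT ^ 3 * σ + gD) / Δ := by ring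
      linarith only [ha, hb, this]
    have hc2 : |gt ^ 2 * Λ * (s (-1) / (d (-1) - d 0))| ≤ gT ^ 2 * Λ * (γ / Δ) := by
      rw [abs_mul, abs_mul, abs_div, abs_of_pos hΛ, abs_of_pos hδm0, abs_pow, sq_abs]
      exact mul_le_mul (mul_le_mul_of_nonneg_right hgt2 hΛ.le) (div_le_div₀ hγ0 hsm1γ hΔ0 hδm)
        (by positivity) (by positivity)
    have t1 : V * |-(gdt * s (-1) / (d (-1) - d 0)) + gt ^ 3 * Λ * σ * (s (-1) / (d (-1) - d 0))| ≤
        V * (γ * (Λ * gT ^ 3 * σ + gD) / Δ) := mul_le_mul_of_nonneg_left hc1 hV0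
    have t2 : |gt ^ 2 * Λ * (s (-1) / (d (-1) - d 0))| * ‖X₁‖ ≤ gT ^ 2 * Λ * (γ / Δ) * (γ * Y₁) :=
      mul_le_mul hc2 hX₁ (norm_nonneg _) (by positivity)
    have : gT ^ 2 * Λ * (γ / Δ) * (γ * Y₁) = Λ * gT ^ 2 * γ ^ 2 * Y₁ / Δ := by ring
    rw [hqa]; linarith only [t1, t2, this]
  have hQ2 : (2 : ℤ) ∈ W' → ‖Q 2‖ ≤ qb := by
    intro _
    have e : Q 2 = (((gt * Λ * s 1 * (gt * s 0 / (d 1 - d 0)) : ℝ)) : ℂ) * x 0 := by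
      have hx1 := hxR 1 (by norm_num)
      have hx3 : x 3 = R 3 := by
        rw [hRne 3 (by norm_num), hf_else 3 (by norm_num) (by norm_num)]; simp
      have hR2 : R 2 = x 2 := by
        rw [hRne 2 (by norm_num), hf_else 2 (by norm_num) (by norm_num)]; simp
      simp only [hQdef, hFv, hd_else 2 (by norm_num) (by norm_num), hf_else 2 (by norm_num) (by norm_num)]
      norm_num
      rw [hR2, hx3, hx1, hf1]
      push_cast
      ring
    rw [e, norm_mul, Complex.norm_real, Real.norm_eq_abs, ← hVdef]
    have hc : |gt * Λ * s 1 * (gt * s 0 / (d 1 - d 0))| ≤ gT * Λ * 1 * (gT * γ / Δ) := by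
      rw [abs_mul, abs_mul, abs_mul, abs_of_pos hΛ]
      exact mul_le_mul (mul_le_mul (mul_le_mul_of_nonneg_right hgt hΛ.le) hs1 (abs_nonneg _) (by positivity))
        (hquot hgt hgT0 hs0γ hδp hδp0) (abs_nonneg _) (by positivity)
    have : gT * Λ * 1 * (gT * γ / Δ) * V = qb := by rw [hqb]; ring
    rw [← this]
    exact mul_le_mul_of_nonneg_right hc hV0
  have hQm2 : (-2 : ℤ) ∈ W' → ‖Q (-2)‖ ≤ qb := by
    intro hm2
    have hsm2 : |s (-2)| ≤ 1 := hs (-2) (Finset.mem_of_mem_erase hm2)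
    have e : Q (-2) = (((gt * Λ * s (-2) * (gt * s (-1) / (d (-1) - d 0)) : ℝ)) : ℂ) * x 0 := by
      have hxm1 := hxR (-1) (by norm_num)
      have hxm3 : x (-3) = R (-3) := by
        rw [hRne (-3) (by norm_num), hf_else (-3) (by norm_num) (by norm_num)]; simp
      have hRm2 : R (-2) = x (-2) := by
        rw [hRne (-2) (by norm_num), hf_else (-2) (by norm_num) (by norm_num)]; simp
      simp only [hQdef, hFv, hd_else (-2) (by norm_num) (by norm_num), hf_else (-2) (by norm_num) (by norm_num)]
      norm_num
      rw [hRm2, hxm3, hxm1, hfm1]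
      push_cast
      ring
    rw [e, norm_mul, Complex.norm_real, Real.norm_eq_abs, ← hVdef]
    have hc : |gt * Λ * s (-2) * (gt * s (-1) / (d (-1) - d 0))| ≤ gT * Λ * 1 * (gT * γ / Δ) := by
      rw [abs_mul, abs_mul, abs_mul, abs_of_pos hΛ]
      exact mul_le_mul (mul_le_mul (mul_le_mul_of_nonneg_right hgt hΛ.le) hsm2 (abs_nonneg _) (by positivity))
        (hquot hgt hgT0 hsm1γ hδm hδm0) (abs_nonneg _) (by positivity)
    have : gT * Λ * 1 * (gT * γ / Δ) * V = qb := by rw [hqb]; ring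
    rw [← this]
    exact mul_le_mul_of_nonneg_right hc hV0
  have hQelse : ∀ J ∈ W', J ≠ 1 → J ≠ -1 → J ≠ 2 → J ≠ -2 → Q J = 0 := by
    intro J hJ hJ1 hJm1 hJ2 hJm2
    have hJ0 : J ≠ 0 := Finset.ne_of_mem_erase hJ
    have hRJ : R J = x J := by rw [hRne J hJ0, hf_else J hJ1 hJm1]; simp
    have hRJm : R (J - 1) = x (J - 1) := by
      rw [hRne (J - 1) (by omega), hf_else (J - 1) (by omega) (by omega)]; simp
    have hRJp : R (J + 1) = x (J + 1) := by
      rw [hRne (J + 1) (by omega), hf_else (J + 1) (by omega) (by omega)]; simp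
    simp only [hQdef, hFv J, hd_else J hJ1 hJm1, hf_else J hJ1 hJm1, hRJ, hRJm, hRJp]
    push_cast
    ring
  -- uniform bound `‖Q J‖ ≤ qf J` on `W'`
  obtain ⟨qf, hqfdef⟩ : ∃ qf : ℤ → ℝ, qf = fun J => if J = 1 ∨ J = -1 then qa else if J = 2 ∨ J = -2 then qb else 0 :=
    ⟨_, rfl⟩
  have hqf0 : ∀ J, 0 ≤ qf J := fun J => by
    simp only [hqfdef]; split_ifs <;> first | exact hqa0 | exact hqb0 | exact le_rfl
  have hQle : ∀ J ∈ W', ‖Q J‖ ≤ qf J := by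
    intro J hJ
    by_cases hJ1 : J = 1
    · subst hJ1; simp only [hqfdef]; simpa using hQ1
    by_cases hJm1 : J = -1
    · subst hJm1; simp only [hqfdef]; norm_num; exact hQm1
    by_cases hJ2 : J = 2
    · subst hJ2; simp only [hqfdef]; norm_num; exact hQ2 hJ
    by_cases hJm2 : J = -2
    · subst hJm2; simp only [hqfdef]; norm_num; exact hQm2 hJ
    rw [hQelse J hJ hJ1 hJm1 hJ2 hJm2, norm_zero]
    exact hqf0 J
  have hqf_sum : ∑ J ∈ W', qf J ≤ 2 * qa + 2 * qb := by
    have hA : ∑ J ∈ W', qf J = ∑ J ∈ W'.filter (fun J => J = 1 ∨ J = -1 ∨ J = 2 ∨ J = -2), qf J := by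
      rw [Finset.sum_filter]
      refine Finset.sum_congr rfl fun J _ => ?_
      split_ifs with h
      · rfl
      · push Not at h
        simp only [hqfdef, if_neg (not_or.2 ⟨h.1, h.2.1⟩), if_neg (not_or.2 ⟨h.2.2.1, h.2.2.2⟩)]
    have hsub : W'.filter (fun J => J = 1 ∨ J = -1 ∨ J = 2 ∨ J = -2) ⊆ ({1, -1, 2, -2} : Finset ℤ) := by
      intro J hJ
      simp only [Finset.mem_filter] at hJ
      simp only [Finset.mem_insert, Finset.mem_singleton]
      exact hJ.2
    have hB := Finset.sum_le_sum_of_subset_of_nonneg hsub (fun J _ _ => hqf0 J)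
    have hC : ∑ J ∈ ({1, -1, 2, -2} : Finset ℤ), qf J = 2 * qa + 2 * qb := by
      rw [Finset.sum_insert (by norm_num), Finset.sum_insert (by norm_num), Finset.sum_pair (by norm_num)]
      simp only [hqfdef]
      norm_num
      ring
    linarith only [hA, hB, hC]
  -- the fast sum
  rw [hFeq, ← hVdef, ← hYdef, ← hcBdef]
  -- goal: `Σ summand ≤ -2Λ(d₀+Δ)F + 4(V Y cB) + 4(Λ gT² γ² F/Δ)`; summand = diagonal + exchange + defect
  have hfast : ∑ J ∈ W', 2 * ((Fv J - ((hd' J : ℂ) * x 0 + (hf J : ℂ) * Fv 0)) * conj (x J - (hf J : ℂ) * x 0)).re ≤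
      -2 * Λ * (d 0 + Δ) * F + 4 * (V * Y * cB) + 4 * (Λ * gT ^ 2 * γ ^ 2 * F / Δ) := by
    -- summand = diagonal + exchange + defect
    have hsummand : ∀ J ∈ W',
        2 * ((Fv J - ((hd' J : ℂ) * x 0 + (hf J : ℂ) * Fv 0)) * conj (x J - (hf J : ℂ) * x 0)).re =
          -2 * Λ * (d J * ‖R J‖ ^ 2) +
            (-2 * (gt * Λ) * (conj (R J) * (((s (J - 1) : ℝ) : ℂ) * R (J - 1) - ((s J : ℝ) : ℂ) * R (J + 1))).re +
              2 * (Q J * conj (R J)).re) := by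
      intro J hJ
      have hJ0 : J ≠ 0 := Finset.ne_of_mem_erase hJ
      have eR : x J - (hf J : ℂ) * x 0 = R J := (hRne J hJ0).symm
      have eF : Fv J - ((hd' J : ℂ) * x 0 + (hf J : ℂ) * Fv 0) =
          (-(Λ : ℂ) * ((d J : ℂ) * R J) - (gt : ℂ) * (Λ : ℂ) * ((s (J - 1) : ℂ) * R (J - 1) - (s J : ℂ) * R (J + 1)))
            + Q J := by simp only [hQdef]; ring
      rw [eR, eF]
      have e2 : ((-(Λ : ℂ) * ((d J : ℂ) * R J) -
            (gt : ℂ) * (Λ : ℂ) * ((s (J - 1) : ℂ) * R (J - 1) - (s J : ℂ) * R (J + 1))) + Q J) * conj (R J) =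
          -(((Λ * d J : ℝ) : ℂ) * (R J * conj (R J))) -
            ((gt * Λ : ℝ) : ℂ) * (conj (R J) * (((s (J - 1) : ℝ) : ℂ) * R (J - 1) - ((s J : ℝ) : ℂ) * R (J + 1))) +
              Q J * conj (R J) := by push_cast; ring
      rw [e2, Complex.add_re, Complex.sub_re, Complex.neg_re, Complex.mul_conj', ← Complex.ofReal_pow,
        ← Complex.ofReal_mul, Complex.ofReal_re, Complex.re_ofReal_mul]
      ring
    rw [Finset.sum_congr rfl hsummand, Finset.sum_add_distrib, Finset.sum_add_distrib]
    -- diagonal part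
    have hdiag : ∑ J ∈ W', -2 * Λ * (d J * ‖R J‖ ^ 2) ≤ -2 * Λ * (d 0 + Δ) * F := by
      rw [hFdef, Finset.mul_sum]
      refine Finset.sum_le_sum fun J hJ => ?_
      have hdJ : d 0 + Δ ≤ d J := hΔ J (Finset.mem_of_mem_erase hJ) (Finset.ne_of_mem_erase hJ)
      have h3 : 0 ≤ 2 * Λ * ‖R J‖ ^ 2 * (d J - (d 0 + Δ)) := mul_nonneg (by positivity) (sub_nonneg.2 hdJ)
      linarith only [h3]
    -- exchange part vanishes
    have hexch : ∑ J ∈ W', -2 * (gt * Λ) *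
        (conj (R J) * (((s (J - 1) : ℝ) : ℂ) * R (J - 1) - ((s J : ℝ) : ℂ) * R (J + 1))).re = 0 := by
      rw [← Finset.mul_sum, ← Complex.re_sum, re_sum_conj_mul_link_eq_zero W' s R hRout, mul_zero]
    -- defect part
    have hdef : ∑ J ∈ W', 2 * (Q J * conj (R J)).re ≤ 2 * ((2 * qa + 2 * qb) * Y) := by
      calc ∑ J ∈ W', 2 * (Q J * conj (R J)).re ≤ ∑ J ∈ W', 2 * (qf J * Y) := by
            refine Finset.sum_le_sum fun J hJ => ?_
            have habs : |(Q J * conj (R J)).re| ≤ ‖Q J‖ * ‖R J‖ :=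
              (Complex.abs_re_le_norm _).trans (le_of_eq (by rw [norm_mul, Complex.norm_conj]))
            have := (le_abs_self _).trans (habs.trans
              (mul_le_mul (hQle J hJ) (hRle J hJ) (norm_nonneg _) (hqf0 J)))
            linarith only [this]
        _ = 2 * ((∑ J ∈ W', qf J) * Y) := by rw [Finset.sum_mul, Finset.mul_sum]
        _ ≤ 2 * ((2 * qa + 2 * qb) * Y) := by
            have := mul_le_mul_of_nonneg_right hqf_sum hY0; linarith only [this]
    have hqsum : (2 * qa + 2 * qb) * Y ≤ 2 * (V * Y * cB) + 2 * (Λ * gT ^ 2 * γ ^ 2 * F / Δ) := by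
      have e : (2 * qa + 2 * qb) * Y = 2 * (V * Y * cB) + 2 * (Λ * gT ^ 2 * γ ^ 2 * (Y₁ * Y) / Δ) := by
        rw [hqa, hqb, hcBdef]; ring
      rw [e]
      have : Y₁ * Y ≤ F := by
        calc Y₁ * Y ≤ Y * Y := mul_le_mul_of_nonneg_right hY₁Y hY0
          _ = F := by rw [← hYsq]; ring
      have h2 : Λ * gT ^ 2 * γ ^ 2 * (Y₁ * Y) / Δ ≤ Λ * gT ^ 2 * γ ^ 2 * F / Δ :=
        div_le_div_of_nonneg_right (mul_le_mul_of_nonneg_left this (by positivity)) hΔ0.le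
      linarith only [h2]
    refine (add_le_add hdiag (add_le_add hexch.le hdef)).trans ?_
    linarith only [hqsum]
  exact hfast

end

end Summit.AnomalousDissipation.AnomalousDissipation.Theorems.SolenoidalFractalHomogenisation.RealisedQuasiStaticCellLaw
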